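import Mathlib
import Summits.ValiantsHypothesis.ValiantsHypothesis.Theorems.ProofCarryingSymmetryRestorationQPESatDefs

/-!
# Route ProofCarryingSymmetry — crux `RestorationQP`, line `registered`: deleting classes from a list of factors

Support file for the crux item `stmt-ValiantsHypothesis-10343` (lead c5, rung S3^(1)-inv, stub
`esat_removeBy_spec`).  The e-saturation `ACStability.esat` peels copies of the pattern of a ground
distributivity instance off the root factors of a normal product with `ACStability.removeBy l M`:
delete from the list of formulas `l`, left to right, one formula of each AC-class in the multiset
`M` (with multiplicity).  This file proves its specification and the elementary consequences the
later parts use: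

* `ACStability.removeBy_sublist`, `ACStability.mem_of_mem_removeBy` — `removeBy l M` is a sublist
  of `l`; `ACStability.removeBy_of_forall_not_mem` — nothing is deleted when no class of `l` lies
  in `M`;
* `ACStability.coe_map_mk_removeBy` (= the registered stub `esat_removeBy_spec`) — when `M` fits
  (`M ≤ ↑(l.map mk)`), the classes of `removeBy l M` are EXACTLY the classes of `l` minus `M`, as
  multisets;
* `ACStability.length_removeBy_add` — hence `|removeBy l M| + |M| = |l|`, and
  `ACStability.map_mk_removeBy_perm_of_perm` — lists with the same classes up to permutation have
  deletions with the same classes up to permutation.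

Everything here is elementary multiset arithmetic (`Multiset.cons_erase`, `Multiset.sub_cons`,
`Multiset.cons_sub_of_le`).
-/

-- single-problem summit: `Summit.ValiantsHypothesis.ValiantsHypothesis.…` is the namespace by design (D-0017)
set_option linter.dupNamespace false

noncomputable section

open scoped Classical

namespace Summit.ValiantsHypothesis.ValiantsHypothesis.Theorems

namespace ACStability

open Literature.Computability.AlgebraicComplexity ACClass

universe u v

variable {𝔽 : Type u} {X : Type v}

/-- `removeBy l M` is a sublist of `l`. [folklore] -/
theorem removeBy_sublist (l : List (PIFormula 𝔽 X)) (M : Multiset (ACClass 𝔽 X)) :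
    (removeBy l M).Sublist l := by
  induction l generalizing M with
  | nil => exact List.Sublist.slnil
  | cons f l ih =>
    by_cases h : mk f ∈ M
    · rw [removeBy_cons_of_mem h]
      exact (ih _).cons f
    · rw [removeBy_cons_of_not_mem h]
      exact (ih _).cons_cons f

/-- Every formula of `removeBy l M` is a formula of `l`. [folklore] -/
theorem mem_of_mem_removeBy {l : List (PIFormula 𝔽 X)} {M : Multiset (ACClass 𝔽 X)}
    {f : PIFormula 𝔽 X} (h : f ∈ removeBy l M) : f ∈ l :=
  (removeBy_sublist l M).subset h

/-- If no class of `l` lies in `M`, nothing is deleted. [folklore] -/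
theorem removeBy_of_forall_not_mem {l : List (PIFormula 𝔽 X)} {M : Multiset (ACClass 𝔽 X)}
    (h : ∀ f ∈ l, mk f ∉ M) : removeBy l M = l := by
  induction l with
  | nil => rfl
  | cons f l ih =>
    rw [removeBy_cons_of_not_mem (h f List.mem_cons_self),
      ih fun g hg => h g (List.mem_cons_of_mem f hg)]

/-- **Specification of `removeBy`.**  When `M` fits into the classes of `l`, deleting one formula
per class of `M` removes exactly `M` from the multiset of classes. [folklore] -/
theorem coe_map_mk_removeBy (l : List (PIFormula 𝔽 X)) {M : Multiset (ACClass 𝔽 X)}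
    (hM : M ≤ ((l.map mk : List (ACClass 𝔽 X)) : Multiset (ACClass 𝔽 X))) :
    (((removeBy l M).map mk : List (ACClass 𝔽 X)) : Multiset (ACClass 𝔽 X)) =
      ((l.map mk : List (ACClass 𝔽 X)) : Multiset (ACClass 𝔽 X)) - M := by
  induction l generalizing M with
  | nil =>
    have hM0 : M = 0 := Multiset.le_zero.1 (by simpa using hM)
    subst hM0
    simp
  | cons f l ih =>
    rw [List.map_cons, ← Multiset.cons_coe] at hM ⊢
    by_cases h : mk f ∈ M
    · rw [removeBy_cons_of_mem h, ih (Multiset.erase_le_iff_le_cons.2 hM)]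
      conv_rhs => rw [← Multiset.cons_erase h, Multiset.sub_cons, Multiset.erase_cons_head]
    · have hM' : M ≤ ((l.map mk : List (ACClass 𝔽 X)) : Multiset (ACClass 𝔽 X)) :=
        (Multiset.le_cons_of_notMem h).1 hM
      rw [removeBy_cons_of_not_mem h, List.map_cons, ← Multiset.cons_coe, ih hM',
        Multiset.cons_sub_of_le _ hM']

/-- Deleting `M` (when it fits) shortens the list by `card M`. [folklore] -/
theorem length_removeBy_add (l : List (PIFormula 𝔽 X)) {M : Multiset (ACClass 𝔽 X)}
    (hM : M ≤ ((l.map mk : List (ACClass 𝔽 X)) : Multiset (ACClass 𝔽 X))) :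
    (removeBy l M).length + Multiset.card M = l.length := by
  have h := congrArg Multiset.card (coe_map_mk_removeBy l hM)
  rw [Multiset.card_sub hM, Multiset.coe_card, Multiset.coe_card, List.length_map,
    List.length_map] at h
  have h' := Multiset.card_le_card hM
  rw [Multiset.coe_card, List.length_map] at h'
  omega

/-- Lists with the same classes (up to permutation) have deletions with the same classes (up to
permutation). [folklore] -/
theorem map_mk_removeBy_perm_of_perm {l l' : List (PIFormula 𝔽 X)}
    (h : (l.map mk).Perm (l'.map mk)) {M : Multiset (ACClass 𝔽 X)}
    (hM : M ≤ ((l.map mk : List (ACClass 𝔽 X)) : Multiset (ACClass 𝔽 X))) :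
    ((removeBy l M).map mk).Perm ((removeBy l' M).map mk) := by
  have hl : ((l.map mk : List (ACClass 𝔽 X)) : Multiset (ACClass 𝔽 X)) = (l'.map mk : List _) :=
    Multiset.coe_eq_coe.2 h
  have hM' : M ≤ ((l'.map mk : List (ACClass 𝔽 X)) : Multiset (ACClass 𝔽 X)) := hl ▸ hM
  exact Multiset.coe_eq_coe.1 (by rw [coe_map_mk_removeBy l hM, coe_map_mk_removeBy l' hM', hl])

end ACStability

open Literature.Computability.AlgebraicComplexity in
/-- **Registered stub `esat_removeBy_spec`.**  Deleting, left to right, one formula per class of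
`M` from `l` removes exactly `M` from the multiset of classes, when `M` fits. [folklore] -/
theorem esat_removeBy_spec : ∀ {𝔽 : Type} {X : Type} (l : List (PIFormula 𝔽 X)) (M : Multiset (ACStability.ACClass 𝔽 X)), M ≤ Multiset.ofList (l.map ACStability.ACClass.mk) → Multiset.ofList ((ACStability.removeBy l M).map ACStability.ACClass.mk) = Multiset.ofList (l.map ACStability.ACClass.mk) - M :=
  fun l _ hM => ACStability.coe_map_mk_removeBy l hM

end Summit.ValiantsHypothesis.ValiantsHypothesis.Theorems

end
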